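import Summits.BirchSwinnertonDyer.BirchSwinnertonDyer.Theorems.SmallImageMuTransferMuTransferX9StepFourCocycleSeams
import Summits.BirchSwinnertonDyer.BirchSwinnertonDyer.Theorems.SmallImageMuTransferMuTransferX9StepFourPackaging
import HarnessLib

/-!
# K6 crux `MuTransferX9` (stmt-BirchSwinnertonDyer-19276), the G3/G4 MEETING POINT of skeleton v6's
# `stub_stepsTwoFourOdd`: STEP 4 (all members of the coefficient family vanish at `q`, x10) + the `q`-TERM
# IDENTITY (Lemma 1 (iii) up to a unit, `bsd-smallim-koly`) ⟹ **`C_i(κ_q(τ_q), Ψc(Fr_q)) = 0` for every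
# `i` with `i + ε < J`** — the conclusion shape of the stub, the identity entering as ONE hypothesis

Cell `b2b-bsdres`, unit `b2b-bsdres-x10` (N2 = X10b at `p = 3` class lead, GEN 38; G4 = STEP 4 hand; crux
19276, cell `bsd-smallim`, skeleton v6 sha16 a90a661b046bb403; the G3/G4 split of `bsd-smallim-k6-c2` g3,
STATUS 14:27Z: «G4 ⊢ from κ_q + the Ψ local conditions: ∀ i, i + ε < 2e'+2 → convCoeff … i (c(res τ_q)) (Ψc Fr)
= 0 (tame symbol up to unit)»). HONEST FRAMING: TOOL theorems; no definition, no named fact, no `sorry`;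
nothing is asserted about any curve, nothing is booked; X9 stays TYPED at class level, X10b (N2) keeps its
label CONSTRUCTION-SHAPED / NEEDS X_A3. `--supports stmt-BirchSwinnertonDyer-19276` (helper; closes nothing).
PARTITION (D-0054): X9 (A4) · X10b (A5, `p = 3`) — `p ≠ 2` throughout.

## The theorem

Data: a number field `K`, an odd prime `p`, `κ : ZpExtension K p`, twists `𝒯_J = κ.twistModP ρ hM J`,
`𝒯'_J = κ.invTwist.twistModP ρ' hM' J`, an equivariant `e : M × M′ → μ_p` (`he`); `inv : LocalInvariants K p`
with the Poitou–Tate vanishing; a set `S` of finite places containing every `v ∣ p` and every ramified place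
of `ρ` (`hSp`, `hur`); `q ∉ S`; a GLOBAL cocycle `c` of `𝒯_J` whose class is unramified off `S ∪ {q}` (the
Kolyvagin class `κ_q` of G3) and a GLOBAL cocycle `Ψc` of `𝒯'_J` whose class `Ψ` satisfies the stub's two
clauses (unramified off `S`; `loc_v (T^ε Ψ) = 0` on `S`); elements `τ_q, Fr_q ∈ Γ_{K_q}` (in the application:
a tame generator and a local Frobenius — NO property of them is used here); trivialisations `ι : ℤ/p →+ R`,
`ι′ : μ_p →+ R` (`ι′` injective) into a commutative ring and a sequence `u` with `u 0` a unit. HYPOTHESIS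
`hQ` = the `q`-term identity of Lemma 1 (iii) INSTANTIATED at these classes, in the local-class currency of
`…X9StepFour{Seams,Sets,ModPTwist}`:
`ι (inv_q (T_q^{J−1−k}(loc_q [c]) ∪ loc_q (T^ε [Ψc]))) = Σ_{j ≤ k} u_j · ι′ (C_{k−j}(c(res τ_q), S^ε Ψc(res Fr_q)))`
for `k < J` (cup product of k6-ty's `twistContPairing` restricted to `Γ_{K_q}`). CONCLUSION
(**`convCoeff_eq_zero_of_qTermIdentity`**): `C_i(c(res τ_q), Ψc(res Fr_q)) = 0` for all `i + ε < J` — by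
`inv_cupProduct_restrict_iterate_localShift_eq_zero_of_stub_hypotheses` (every LHS vanishes) and the
triangular packaging `convCoeff_eq_zero_of_family_eq_zero` (`u 0` unit, `ι′` injective, `T^ε` moved out of
the right slot). `…_modPTwist` is the same on the stub's objects (`W.modPTwist`, `weilPairingHom` + `hgal`).

How the remaining hands plug in (nothing of it asserted here): koly's `…X9LocalQTerm` gives `hQ` with its
`u = u_q` (apply it to the local representatives `φ := c ∘ res_q`, `ψ := (S^ε ∘ Ψc) ∘ res_q`, whose classes
are `loc_q [c]` / `loc_q (T^ε [Ψc])` by `localization_oneCocycleClass` /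
`localization_iterate_shiftH1_oneCocycleClass`, whose values are `c(res τ_q)` / `S^ε Ψc(res Fr_q)`
(`localCocycle_iterate_shift_apply`), `[φ] ∈ H¹_tr` from G3 and `ψ|_{I_q} = 0` by
`localCocycle_iterate_shift_apply_eq_zero_of_mem_absInertia`); G3 gives `c(res τ_q) = aeval S U (S^(e'+1+a)(Φ Fr))`;
x9's `…X9StepsTwoFourTransport` lifts the statement from `(𝔓₀, res Fr_q)` to every `(𝔓, Fr)` of the stub.

References: MU-TRANSFER-PROOF §2 Lemma 1 (iii), §5 STEP 4, (F7); B. Mazur, K. Rubin, Mem. AMS 799 (2004)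
Prop. 1.3.2, §4.4 [MazurRubin2004]; J. S. Milne, *Arithmetic Duality Theorems* (2006), I Thm. 4.10 (b)
[MilneADT2006].
-/

-- the summit and its single problem are both named `BirchSwinnertonDyer` (registry layout D-0017)
set_option linter.dupNamespace false

set_option autoImplicit false

noncomputable section

open scoped ContRepresentation
open Function NumberField IsDedekindDomain Field Finset
open scoped NumberField
open Literature.NumberTheory.GaloisRepresentations
open Literature.NumberTheory.GaloisRepresentations.DiscreteGaloisModule (mu MuCarrier pairing TateDual
  tateDual pairingDualIntertwining)
open Literature.NumberTheory.GaloisCohomology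
open Literature.NumberTheory.EllipticCurves
open Summit.BirchSwinnertonDyer.Rank1Residual.GaloisImage
open _root_.TopRep _root_.ContRepresentation _root_.ContinuousCohomology

universe u

namespace Summit.BirchSwinnertonDyer.BirchSwinnertonDyer.Rank1Residual.StepFour

section Generic

variable {K : Type u} [Field K] [NumberField K] {p : ℕ} [Fact p.Prime] (κ : ZpExtension K p)
variable {M M' : Type u} [AddCommGroup M] [TopologicalSpace M] [DiscreteTopology M] [Finite M]
  [AddCommGroup M'] [TopologicalSpace M'] [DiscreteTopology M']
variable (ρ : DiscreteGaloisModule K M) (ρ' : DiscreteGaloisModule K M')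
  (hM : ∀ x : M, p • x = 0) (hM' : ∀ x : M', p • x = 0) (J : ℕ)
variable {e : M →+ M' →+ MuCarrier K p}
  (he : ∀ (g : absoluteGaloisGroup K) (m : M) (m' : M'), e (ρ g m) (ρ' g m') = mu K p g (e m m'))
variable [LocallyCompactSpace (absoluteGaloisGroup K)]

/-- **The G3/G4 meeting point of `stub_stepsTwoFourOdd` (generic twists): STEP 4 + the `q`-term identity ⟹
`C_i(c(res τ_q), Ψc(res Fr_q)) = 0` for every `i + ε < J`.** See the module docstring for the binders; `hQ`
is Lemma 1 (iii) (up to the unit `u`) instantiated at the local classes `loc_q [c]`, `loc_q (T^ε [Ψc])`.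
[cite: MazurRubin2004, Prop. 1.3.2 and §4.4] [cite: MilneADT2006, Ch. I, Thm. 4.10(b)] -/
theorem convCoeff_eq_zero_of_qTermIdentity (hp : p ≠ 2) {inv : LocalInvariants K p}
    (hPT : inv.SumLocalTermEqZero) (S : Set (HeightOneSpectrum (𝓞 K))) (q : HeightOneSpectrum (𝓞 K))
    (hq : q ∉ S) [LocallyCompactSpace (absoluteGaloisGroup (Place.Completion (Sum.inr q : Place K)))]
    (hSp : ∀ v ∉ S, ((p : ℕ) : 𝓞 K) ∉ v.asIdeal) (hur : ∀ v ∉ S, GaloisRep.IsUnramifiedAt v ρ)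
    (c : contOneCocycles (κ.twistModP ρ hM J).toTopRep)
    (hx : ∀ v ∉ S, v ≠ q → galoisCohomology.localization (κ.twistModP ρ hM J) (Sum.inr v) 1
        (oneCocycleClass (κ.twistModP ρ hM J).toTopRep c) ∈
      DiscreteGaloisModule.unramifiedSubgroup (GaloisRep.toLocal v (κ.twistModP ρ hM J)) 1)
    (Ψc : contOneCocycles (κ.invTwist.twistModP ρ' hM' J).toTopRep)
    (hΨ : ∀ v ∉ S, galoisCohomology.localization (κ.invTwist.twistModP ρ' hM' J) (Sum.inr v) 1
        (oneCocycleClass (κ.invTwist.twistModP ρ' hM' J).toTopRep Ψc) ∈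
      DiscreteGaloisModule.unramifiedSubgroup (GaloisRep.toLocal v (κ.invTwist.twistModP ρ' hM' J)) 1)
    (ε : ℕ)
    (hΨS : ∀ v ∈ S, galoisCohomology.localization (κ.invTwist.twistModP ρ' hM' J) (Sum.inr v) 1
      ((κ.invTwist.shiftH1 ρ' hM' J)^[ε] (oneCocycleClass (κ.invTwist.twistModP ρ' hM' J).toTopRep Ψc)) = 0)
    (τq Frq : absoluteGaloisGroup (q.adicCompletion K))
    {R : Type*} [CommRing R] (ι : ZMod p →+ R) (ι' : MuCarrier K p →+ R) (hι' : Function.Injective ι')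
    (u : ℕ → R) (hu : IsUnit (u 0))
    (hQ : ∀ k < J, ι (inv (Sum.inr q)
        (((κ.twistContPairing ρ ρ' (mu K p) hM hM' J he).restrict
            (absGaloisRestrict K (Place.Completion (Sum.inr q : Place K)))).cupProduct
          ((galoisCohomology.map ((κ.twistModPShift ρ hM J).restrictField (q.adicCompletion K)) 1)^[J - 1 - k]
            (galoisCohomology.localization (κ.twistModP ρ hM J) (Sum.inr q) 1
              (oneCocycleClass (κ.twistModP ρ hM J).toTopRep c)))
          (galoisCohomology.localization (κ.invTwist.twistModP ρ' hM' J) (Sum.inr q) 1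
            ((κ.invTwist.shiftH1 ρ' hM' J)^[ε]
              (oneCocycleClass (κ.invTwist.twistModP ρ' hM' J).toTopRep Ψc))))) =
      ∑ j ∈ range (k + 1), u j * ι' (convCoeff e J (k - j)
        (c.1 (absGaloisRestrict K (q.adicCompletion K) τq))
        ((shiftEnd M' J ^ ε) (Ψc.1 (absGaloisRestrict K (q.adicCompletion K) Frq))))) :
    ∀ i, i + ε < J → convCoeff e J i (c.1 (absGaloisRestrict K (q.adicCompletion K) τq))
      (Ψc.1 (absGaloisRestrict K (q.adicCompletion K) Frq)) = 0 := by
  refine convCoeff_eq_zero_of_family_eq_zero e ι' hι' hu ε _ _ fun k hk => ?_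
  rw [← hQ k hk, inv_cupProduct_restrict_iterate_localShift_eq_zero_of_stub_hypotheses κ ρ ρ' hM hM' J he hp
    hPT S q hq hSp hur _ hx _ hΨ ε hΨS (J - 1 - k), map_zero]

end Generic

/-! ### The same on the objects of `stub_stepsTwoFourOdd` (`ℚ`, `W.modPTwist`, a Weil pairing `eW`) -/

section Curve

variable (W : WeierstrassCurve ℚ) (p : ℕ) [Fact p.Prime] (κ : ZpExtension ℚ p)
variable (eW : WeierstrassCurve.geomTorsion W (p : ℤ) → WeierstrassCurve.geomTorsion W (p : ℤ) →
    AlgebraicClosure ℚ)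
  (hμ : ∀ S T, eW S T ^ p = 1) (hadd₁ : ∀ S₁ S₂ T, eW (S₁ + S₂) T = eW S₁ T * eW S₂ T)
  (hadd₂ : ∀ S T₁ T₂, eW S (T₁ + T₂) = eW S T₁ * eW S T₂)
  (hgal : ∀ (σ : absoluteGaloisGroup ℚ) (S T : WeierstrassCurve.geomTorsion W (p : ℤ)),
    σ • eW S T = eW (σ • S) (σ • T))

/-- **The G3/G4 meeting point of `stub_stepsTwoFourOdd` on its own objects.** `p ≠ 2`; `c` a cocycle of the
Kolyvagin class in `H¹(ℚ, W.modPTwist p κ J)` (unramified off `S ∪ {q}`); `Ψc` the stub's cocycle with its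
two clauses; `hQ` = Lemma 1 (iii) instantiated (local-class currency, Weil pairing through `weilPairingHom`,
`he := weilPairingHom_torsionGaloisModule_smul … hgal`) ⟹ `convCoeff (weilPairingHom …) J i (c(res τ_q))
(Ψc(res Fr_q)) = 0` for all `i + ε < J`. [cite: MazurRubin2004, Prop. 1.3.2 and §4.4] [cite: MilneADT2006, Ch. I, Thm. 4.10(b)] -/
theorem convCoeff_eq_zero_of_qTermIdentity_modPTwist [W.IsElliptic]
    [Finite (WeierstrassCurve.geomTorsion W (p : ℤ))] [LocallyCompactSpace (absoluteGaloisGroup ℚ)]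
    (hp : p ≠ 2) {inv : LocalInvariants ℚ p} (hPT : inv.SumLocalTermEqZero) (J : ℕ)
    (S : Set (HeightOneSpectrum (𝓞 ℚ))) (q : HeightOneSpectrum (𝓞 ℚ)) (hq : q ∉ S)
    [LocallyCompactSpace (absoluteGaloisGroup (Place.Completion (Sum.inr q : Place ℚ)))]
    (hSp : ∀ v ∉ S, ((p : ℕ) : 𝓞 ℚ) ∉ v.asIdeal)
    (hur : ∀ v ∉ S, GaloisRep.IsUnramifiedAt v (W.torsionGaloisModule (p : ℤ)))
    (c : contOneCocycles (W.modPTwist p κ J).toTopRep)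
    (hx : ∀ v ∉ S, v ≠ q → galoisCohomology.localization (W.modPTwist p κ J) (Sum.inr v) 1
        (oneCocycleClass (W.modPTwist p κ J).toTopRep c) ∈
      DiscreteGaloisModule.unramifiedSubgroup (GaloisRep.toLocal v (W.modPTwist p κ J)) 1)
    (Ψc : contOneCocycles (W.modPTwist p κ.invTwist J).toTopRep)
    (hΨ : ∀ v : HeightOneSpectrum (𝓞 ℚ), v ∉ S →
      galoisCohomology.localization (W.modPTwist p κ.invTwist J) (Sum.inr v) 1
          (oneCocycleClass (W.modPTwist p κ.invTwist J).toTopRep Ψc) ∈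
        DiscreteGaloisModule.unramifiedSubgroup (GaloisRep.toLocal v (W.modPTwist p κ.invTwist J)) 1)
    (ε : ℕ)
    (hΨS : ∀ v : HeightOneSpectrum (𝓞 ℚ), v ∈ S →
      galoisCohomology.localization (W.modPTwist p κ.invTwist J) (Sum.inr v) 1
        ((κ.invTwist.shiftH1 (W.torsionGaloisModule (p : ℤ))
          (fun P : WeierstrassCurve.geomTorsion W (p : ℤ) => AddSubgroup.torsionBy.nsmul P) J)^[ε]
          (oneCocycleClass (W.modPTwist p κ.invTwist J).toTopRep Ψc)) = 0)
    (τq Frq : absoluteGaloisGroup (q.adicCompletion ℚ))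
    {R : Type*} [CommRing R] (ι : ZMod p →+ R) (ι' : MuCarrier ℚ p →+ R) (hι' : Function.Injective ι')
    (u : ℕ → R) (hu : IsUnit (u 0))
    (hQ : ∀ k < J, ι (inv (Sum.inr q)
        (((κ.twistContPairing (W.torsionGaloisModule (p : ℤ)) (W.torsionGaloisModule (p : ℤ)) (mu ℚ p)
              (fun P => AddSubgroup.torsionBy.nsmul P) (fun P => AddSubgroup.torsionBy.nsmul P) J
              (weilPairingHom_torsionGaloisModule_smul W p eW hμ hadd₁ hadd₂ hgal)).restrict
            (absGaloisRestrict ℚ (Place.Completion (Sum.inr q : Place ℚ)))).cupProduct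
          ((galoisCohomology.map ((κ.twistModPShift (W.torsionGaloisModule (p : ℤ))
              (fun P => AddSubgroup.torsionBy.nsmul P) J).restrictField (q.adicCompletion ℚ)) 1)^[J - 1 - k]
            (galoisCohomology.localization (W.modPTwist p κ J) (Sum.inr q) 1
              (oneCocycleClass (W.modPTwist p κ J).toTopRep c)))
          (galoisCohomology.localization (W.modPTwist p κ.invTwist J) (Sum.inr q) 1
            ((κ.invTwist.shiftH1 (W.torsionGaloisModule (p : ℤ))
              (fun P : WeierstrassCurve.geomTorsion W (p : ℤ) => AddSubgroup.torsionBy.nsmul P) J)^[ε]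
              (oneCocycleClass (W.modPTwist p κ.invTwist J).toTopRep Ψc))))) =
      ∑ j ∈ range (k + 1), u j * ι' (convCoeff (weilPairingHom W p eW hμ hadd₁ hadd₂) J (k - j)
        (c.1 (absGaloisRestrict ℚ (q.adicCompletion ℚ) τq))
        ((shiftEnd (WeierstrassCurve.geomTorsion W (p : ℤ)) J ^ ε)
          (Ψc.1 (absGaloisRestrict ℚ (q.adicCompletion ℚ) Frq))))) :
    ∀ i, i + ε < J → convCoeff (weilPairingHom W p eW hμ hadd₁ hadd₂) J i
      (c.1 (absGaloisRestrict ℚ (q.adicCompletion ℚ) τq)) (Ψc.1 (absGaloisRestrict ℚ (q.adicCompletion ℚ) Frq)) =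
      0 := by
  unfold WeierstrassCurve.modPTwist at c hx Ψc hΨ hΨS hQ ⊢
  exact convCoeff_eq_zero_of_qTermIdentity κ (W.torsionGaloisModule (p : ℤ)) (W.torsionGaloisModule (p : ℤ))
    (fun P => AddSubgroup.torsionBy.nsmul P) (fun P => AddSubgroup.torsionBy.nsmul P) J
    (weilPairingHom_torsionGaloisModule_smul W p eW hμ hadd₁ hadd₂ hgal) hp hPT S q hq hSp hur c hx Ψc hΨ ε hΨS
    τq Frq ι ι' hι' u hu hQ

end Curve

end Summit.BirchSwinnertonDyer.BirchSwinnertonDyer.Rank1Residual.StepFour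

end
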